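import Literature.Combinatorics.Digraph.MultidigraphLaplacianCharpoly
import HarnessLib

/-!
# The Laplace characteristic polynomial of the arc digraph of an arbitrary directed multigraph and
# Knuth's theorem in Levine's form `κ(LG) = κ(G) · ∏_v outdeg(v)^{indeg(v) − 1}`

Topic `Literature/Combinatorics/Digraph`, namespace `Literature.Combinatorics.Digraph.Multidigraph`.
Lane `lit-hodgefound`, seat p23, generation 46, row g46-#8 of the programme «The spectrum of the arc
digraph and de Bruijn's count `2^{2^{n−1}−n}`» (sequel of `MultidigraphLaplacianCharpoly`; the regular
case is `LineDigraphArborescences`).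

## Sources, verbatim

* L. Levine, *Sandpile groups and spanning trees of directed line graphs*, J. Combin. Theory Ser. A
  118 (2011) 350–364 [Levine2011] (held text `paper:arxiv-0906.2809`, chunk p0003): «Let `G = (V, E)`
  be a finite directed graph, which may have loops and multiple edges. Each edge `e ∈ E` is directed
  from its source vertex `s(e)` to its target vertex `t(e)`. The directed line graph `LG = (E, E₂)` has
  as vertices the edges of `G`, and as edges the set `E₂ = {(e₁, e₂) ∈ E × E | s(e₂) = t(e₁)}`. […] An
  oriented spanning tree of `G` is a subgraph containing all of the vertices of `G`, having no directed
  cycles, in which one vertex, the root, has outdegree `0`, and every other vertex has outdegree `1`.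
  The number `κ(G)` of oriented spanning trees of `G` is sometimes called the complexity of `G`. […]
  **Theorem 1.1.** Let `G = (V, E)` be a finite directed graph with no sources. Then
  `κ^{vertex}(LG, x) = κ^{edge}(G, x) ∏_{v ∈ V} (Σ_{s(e) = v} x_e)^{indeg(v) − 1}`. (1) […] Setting all
  `x_e = 1` yields the product formula `κ(LG) = κ(G) ∏_{v ∈ V} outdeg(v)^{indeg(v) − 1}` (2) due in a
  slightly different form to Knuth [Knuth67]. Special cases of (2) include Cayley's formula `n^{n−1}`
  for the number of rooted spanning trees of the complete graph `K_n`, as well as the formula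
  `(m+n)m^{n−1}n^{m−1}` for the number of rooted spanning trees of the complete bipartite graph
  `K_{m,n}`. These are respectively the cases that `G` has just one vertex with `n` loops, or `G` has
  just two vertices `a` and `b` with `m` edges directed from `a` to `b` and `n` edges directed from `b`
  to `a`.»
* D. E. Knuth, *Oriented subtrees of an arc digraph*, J. Combin. Theory 3 (1967) 309–314 [Knuth1967],
  Theorem (5) and Corollary (7) («If `D` is a balanced digraph, the number of oriented subtrees of `D*`
  with root `A_{j₀k₀}` is `σ₁^{σ₁−1}σ₂^{σ₂−1}⋯σ_m^{σ_m−1} t/σ_{k₀}`»).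

## The proof formalised here (spectral, for every finite directed multigraph)

With the incidence matrices `T` (heads) and `S` (tails) of `MultidigraphAdjacencyMatrix`:
`L(G) = Δ − SᵀT`, `L(G*) = Δ* − TSᵀ`, `Δ = diag(σ_v)`, `Δ* = diag(σ_{tgt a})`, and `Δ*T = TΔ`. For
matrices with `D₁P = PD₂` one has the intertwined Sylvester identity
`det(D₁ + PQ)·det D₂ = det D₁·det(D₂ + QP)` (§1, by two block factorisations of one block matrix);
applied to `D₁ = X − Δ*`, `D₂ = X − Δ`, `P = T`, `Q = −Sᵀ` over `R[X]` it gives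
**`χ_{L(G*)}(X) · ∏_v (X − σ_v) = ∏_a (X − σ_{tgt a}) · χ_{L(G)}(X)`** (§2). Comparing the coefficients
of `X` (both characteristic polynomials have zero constant term; `χ.coeff 1 = (−1)^{·−1} Σ_roots t⁻` by
`MultidigraphLaplacianCharpoly`) yields the division-free form of (2):
`κ(G*) · ∏_v σ_v = ∏_v σ_v^{indeg v} · κ(G)`, `κ` = the total number of converging spanning
arborescences over all roots (§3).

## What is here (theorems only; no definition, no named fact, no instance, no notation)

* §1 `det_add_mul_mul_det_eq_of_mul_eq_mul` — the intertwined Sylvester identity.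
* §2 `tgtMatrix_mul_diagonal`, **`charpoly_laplacian_lineDigraph_mul`** — the characteristic
  polynomial identity above, for every finite directed multigraph and commutative ring.
* §3 **`sum_card_arborescencesTo_lineDigraph_mul`** — `κ(G*)·∏_v σ_v = (∏_v σ_v^{indeg v})·κ(G)`
  (`G` with at least one arc); **`sum_card_arborescencesTo_lineDigraph`** — Levine's (2),
  `κ(G*) = κ(G)·∏_v σ_v^{indeg v − 1}`, for `G` without sources and without sinks;
  **`sum_card_arborescencesTo_lineDigraph_of_balanced`** — for balanced `G`:
  `κ(G*) = N · ∏_v σ_v^{σ_v − 1} · t⁻(G, s)` (Knuth's Corollary (7) summed over the roots of `G*`).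
* §4 Levine's two examples: the bouquet of `n` loops (`κ(G*) = n^{n−1}`, Cayley) and the digraph with
  two vertices, `m` arcs one way and `n` the other (`κ(G*) = (m+n)m^{n−1}n^{m−1}`).

Not here: Theorem 1.1 with the indeterminates `x_e` (the same matrix identity with weighted incidence
matrices; `TODO(general form): Levine2011 Thm 1.1`), Knuth's root-by-root (5)/(7), and Levine's
Theorem 1.2 on sandpile groups.

## References

* [Levine2011] L. Levine, *Sandpile groups and spanning trees of directed line graphs*, J. Combin.
  Theory Ser. A 118 (2011) 350–364, Thm. 1.1 and eq. (2).
* [Knuth1967] D. E. Knuth, *Oriented subtrees of an arc digraph*, J. Combin. Theory 3 (1967) 309–314,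
  Theorem (5), Corollary (7).
* [Stanley2013AlgebraicCombinatorics] R. P. Stanley, *Algebraic Combinatorics*, Lemma 9.9 (the
  coefficient of `x`).
-/

namespace Literature.Combinatorics.Digraph

namespace Multidigraph

open Finset Matrix Polynomial

/-! ### §1 The intertwined Sylvester identity -/

section MatrixLemma

variable {m n S : Type*} [Fintype m] [Fintype n] [DecidableEq m] [DecidableEq n] [CommRing S]

/-- **`det(D₁ + PQ) · det D₂ = det D₁ · det(D₂ + QP)` whenever `D₁P = PD₂`** (for `D₁ = D₂ = X·1`
this is Sylvester's `X^n χ_{QP}… = X^m χ_{PQ}…`). Proof: the block matrix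
`[[D₁, PD₂], [−Q, D₂]] = [[D₁, P], [−Q, 1]]·[[1, 0], [0, D₂]] = [[D₁, 0], [0, 1]]·[[1, P], [−Q, D₂]]`
has determinant `det(D₁ + PQ)·det D₂` by the first factorisation and `det D₁·det(D₂ + QP)` by the
second. [cite: Levine2011, eq. (2) (the engine of the spectral proof given here); Knuth1967, p. 311
(«`det C*_λ = λt`»)] -/
theorem det_add_mul_mul_det_eq_of_mul_eq_mul (D₁ : Matrix m m S) (D₂ : Matrix n n S)
    (P : Matrix m n S) (Q : Matrix n m S) (h : D₁ * P = P * D₂) :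
    (D₁ + P * Q).det * D₂.det = D₁.det * (D₂ + Q * P).det := by
  have hU : (fromBlocks D₁ P (-Q) (1 : Matrix n n S)).det = (D₁ + P * Q).det := by
    rw [det_fromBlocks_one₂₂, Matrix.mul_neg, sub_neg_eq_add]
  have hW : (fromBlocks (1 : Matrix m m S) P (-Q) D₂).det = (D₂ + Q * P).det := by
    rw [det_fromBlocks_one₁₁, Matrix.neg_mul, sub_neg_eq_add]
  have hprod : fromBlocks D₁ P (-Q) (1 : Matrix n n S) * fromBlocks 1 0 0 D₂ =
      fromBlocks D₁ 0 0 (1 : Matrix n n S) * fromBlocks 1 P (-Q) D₂ := by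
    rw [fromBlocks_multiply, fromBlocks_multiply]
    simp [h]
  have hdet := congrArg Matrix.det hprod
  rw [det_mul, det_mul, hU, hW, det_fromBlocks_zero₂₁, det_fromBlocks_zero₂₁, det_one, det_one,
    one_mul, mul_one] at hdet
  exact hdet

end MatrixLemma

/-! ### §2 `χ_{L(G*)} · ∏_v (X − σ_v) = ∏_a (X − σ_{tgt a}) · χ_{L(G)}` -/

section Charpoly

variable {V A : Type*} (G : Multidigraph V A) (R : Type*) [CommRing R]
variable [Fintype V] [DecidableEq V] [Fintype A] [DecidableEq A]

/-- `T · diag(d) = diag(d ∘ tgt) · T`: the head incidence matrix intertwines a vertex weight with its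
pull-back to the arcs (`Δ*T = TΔ`). [cite: Levine2011, §1 (the map `φ : e ↦ t(e)`); Knuth1967,
p. 310] -/
theorem tgtMatrix_mul_diagonal {S : Type*} [CommRing S] (d : V → S) :
    G.tgtMatrix S * diagonal d = diagonal (fun a => d (G.tgt a)) * G.tgtMatrix S := by
  ext a v
  rw [mul_diagonal, diagonal_mul, tgtMatrix_apply]
  by_cases h : G.tgt a = v
  · rw [if_pos h, h, one_mul, mul_one]
  · rw [if_neg h, zero_mul, mul_zero]

/-- **The Laplace characteristic polynomials of `G*` and `G`**:
`χ_{L(G*)}(X) · ∏_v (X − σ_v) = ∏_a (X − σ_{tgt a}) · χ_{L(G)}(X)` for every finite directed multigraph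
(`σ` = out-degree): the Laplace spectrum of the arc digraph is that of `G` with the multiset
`{σ_v : v}` replaced by `{σ_{tgt a} : a}`. [cite: Levine2011, eq. (2) (this identity is its
characteristic-polynomial form); Knuth1967, Theorem (5)] -/
theorem charpoly_laplacian_lineDigraph_mul :
    (G.lineDigraph.laplacian R).charpoly * ∏ v, (X - C (G.outDeg v : R)) =
      (∏ a, (X - C (G.outDeg (G.tgt a) : R))) * (G.laplacian R).charpoly := by
  -- the four matrices over `R[X]`
  set P : Matrix A V R[X] := G.tgtMatrix R[X] with hP
  set Q : Matrix V A R[X] := (G.srcMatrix R[X])ᵀ with hQ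
  set D₁ : Matrix A A R[X] := diagonal fun a => X - C (G.outDeg (G.tgt a) : R) with hD₁
  set D₂ : Matrix V V R[X] := diagonal fun v => X - C (G.outDeg v : R) with hD₂
  -- intertwining `D₁ P = P D₂`
  have hcomm : D₁ * P = P * D₂ := by
    rw [hP, hD₁, hD₂, G.tgtMatrix_mul_diagonal]
  -- `P Q = A(G*)`, `Q P = A(G)` (as `0/1`-matrices over `R[X]`)
  have hPQ : P * Q = G.lineDigraph.adjMatrix R[X] := by rw [hP, hQ, adjMatrix_lineDigraph]
  have hQP : Q * P = G.adjMatrix R[X] := by rw [hP, hQ, srcMatrix_transpose_mul_tgtMatrix]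
  -- the two characteristic matrices
  have h1 : charmatrix (G.lineDigraph.laplacian R) = D₁ + P * Q := by
    rw [hPQ]
    refine Matrix.ext fun a b => ?_
    rw [charmatrix_apply, Matrix.add_apply, laplacian_eq_diagonal_sub_adjMatrix, Matrix.sub_apply,
      adjMatrix_apply, adjMatrix_apply, hD₁, diagonal_apply, diagonal_apply, diagonal_apply,
      outDeg_lineDigraph, map_sub, map_natCast, map_natCast]
    split_ifs with hab
    · simp only [map_natCast]; ring
    · simp
  have h2 : charmatrix (G.laplacian R) = D₂ + Q * P := by
    rw [hQP]
    refine Matrix.ext fun u v => ?_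
    rw [charmatrix_apply, Matrix.add_apply, laplacian_eq_diagonal_sub_adjMatrix, Matrix.sub_apply,
      adjMatrix_apply, adjMatrix_apply, hD₂, diagonal_apply, diagonal_apply, diagonal_apply, map_sub,
      map_natCast, map_natCast]
    split_ifs with huv
    · simp only [map_natCast]; ring
    · simp
  have hdet₁ : D₁.det = ∏ a, (X - C (G.outDeg (G.tgt a) : R)) := by rw [hD₁, det_diagonal]
  have hdet₂ : D₂.det = ∏ v, (X - C (G.outDeg v : R)) := by rw [hD₂, det_diagonal]
  have key := det_add_mul_mul_det_eq_of_mul_eq_mul D₁ D₂ P Q hcomm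
  rw [← h1, ← h2, hdet₁, hdet₂] at key
  exact key

end Charpoly

/-! ### §3 The coefficient of `X`: `κ(G*)·∏σ_v = ∏σ_v^{indeg v}·κ(G)` and Levine's (2) -/

section Count

variable {V A : Type*} (G : Multidigraph V A)
variable [Fintype V] [DecidableEq V] [Fintype A] [DecidableEq A]

/-- The constant coefficient of `∏_i (X − c_i)` is `(−1)^{#ι} ∏ c_i`. [cite: Stanley2013AlgebraicCombinatorics,
Cor. 9.10 (proof)] -/
theorem coeff_zero_prod_X_sub_C {ι : Type*} [Fintype ι] {R : Type*} [CommRing R] (c : ι → R) :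
    (∏ i, (X - C (c i))).coeff 0 = (-1) ^ Fintype.card ι * ∏ i, c i := by
  rw [coeff_zero_eq_eval_zero, eval_prod]
  simp only [eval_sub, eval_X, eval_C, zero_sub]
  rw [Finset.prod_neg, Finset.card_univ]

/-- The coefficient of `X` in `p · q` when `p(0) = 0`: `p₁ q₀`. [cite: Stanley2013AlgebraicCombinatorics,
Lemma 9.9 (proof)] -/
theorem coeff_one_mul_of_coeff_zero_eq_zero {R : Type*} [CommRing R] (p q : R[X]) (hp : p.coeff 0 = 0) :
    (p * q).coeff 1 = p.coeff 1 * q.coeff 0 := by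
  obtain ⟨p', rfl⟩ := X_dvd_iff.2 hp
  rw [mul_assoc, coeff_X_mul, coeff_X_mul, mul_coeff_zero]

omit [DecidableEq A] in
/-- `∏_a σ_{tgt a} = ∏_v σ_v^{indeg v}`. [cite: Levine2011, eq. (2)] -/
theorem prod_outDeg_tgt : ∏ a, G.outDeg (G.tgt a) = ∏ v, G.outDeg v ^ G.inDeg v := by
  rw [← Finset.prod_fiberwise_of_maps_to (g := G.tgt) (t := (univ : Finset V)) (fun a _ => mem_univ _)]
  refine Finset.prod_congr rfl fun v _ => ?_
  rw [Finset.prod_congr rfl fun a (ha : a ∈ univ.filter fun a => G.tgt a = v) => by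
    rw [(Finset.mem_filter.1 ha).2], Finset.prod_const]
  rfl

/-- **`κ(G*) · ∏_v σ_v = (∏_v σ_v^{indeg v}) · κ(G)`** — the division-free form of Levine's (2) ∕
Knuth's theorem, for EVERY finite directed multigraph with at least one arc; `κ(·) = Σ_roots t⁻(·, root)`
the total number of converging spanning arborescences («oriented spanning trees», all roots).
[cite: Levine2011, eq. (2); Knuth1967, Theorem (5)] -/
theorem sum_card_arborescencesTo_lineDigraph_mul [Nonempty A] :
    (∑ a, (G.lineDigraph.arborescencesTo a).card) * ∏ v, G.outDeg v =
      (∏ v, G.outDeg v ^ G.inDeg v) * ∑ v, (G.arborescencesTo v).card := by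
  classical
  obtain ⟨a₀⟩ := (inferInstance : Nonempty A)
  haveI : Nonempty V := ⟨G.src a₀⟩
  have key := congrArg (fun p : ℤ[X] => p.coeff 1) (G.charpoly_laplacian_lineDigraph_mul ℤ)
  rw [coeff_one_mul_of_coeff_zero_eq_zero _ _ (G.lineDigraph.charpoly_laplacian_coeff_zero ℤ),
    mul_comm (∏ a, (X - C ((G.outDeg (G.tgt a) : ℕ) : ℤ))) _,
    coeff_one_mul_of_coeff_zero_eq_zero _ _ (G.charpoly_laplacian_coeff_zero ℤ),
    coeff_zero_prod_X_sub_C, coeff_zero_prod_X_sub_C, G.lineDigraph.charpoly_laplacian_coeff_one ℤ,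
    G.charpoly_laplacian_coeff_one ℤ] at key
  rw [← prod_outDeg_tgt]
  -- cancel the signs
  obtain ⟨n, hn⟩ : ∃ n, Fintype.card V = n + 1 := Nat.exists_eq_succ_of_ne_zero Fintype.card_ne_zero
  obtain ⟨m, hm⟩ : ∃ m, Fintype.card A = m + 1 := Nat.exists_eq_succ_of_ne_zero Fintype.card_ne_zero
  rw [hn, hm, Nat.add_sub_cancel, Nat.add_sub_cancel] at key
  have hu : IsUnit ((-1 : ℤ) ^ m * (-1) ^ n) := ((isUnit_one.neg).pow _).mul ((isUnit_one.neg).pow _)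
  have key' : ((-1 : ℤ) ^ m * (-1) ^ n) *
      (((∑ a, (G.lineDigraph.arborescencesTo a).card : ℕ) : ℤ) * ((∏ v, G.outDeg v : ℕ) : ℤ)) =
      ((-1 : ℤ) ^ m * (-1) ^ n) *
        (((∏ a, G.outDeg (G.tgt a) : ℕ) : ℤ) * ((∑ v, (G.arborescencesTo v).card : ℕ) : ℤ)) := by
    push_cast at key ⊢
    linear_combination (-1 : ℤ) * key
  exact_mod_cast hu.mul_right_injective key'

/-- **Levine's (2): `κ(LG) = κ(G) · ∏_v outdeg(v)^{indeg(v) − 1}`** («due in a slightly different form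
to Knuth»), here for a finite directed multigraph without sources (`indeg ≥ 1`, as in the source) and
without sinks (`outdeg ≥ 1`, needed to cancel in the division-free identity above).
[cite: Levine2011, eq. (2) and Thm. 1.1 (at `x_e = 1`); Knuth1967, Theorem (5)] -/
theorem sum_card_arborescencesTo_lineDigraph (hin : ∀ v, 0 < G.inDeg v) (hout : ∀ v, 0 < G.outDeg v) :
    ∑ a, (G.lineDigraph.arborescencesTo a).card =
      (∑ v, (G.arborescencesTo v).card) * ∏ v, G.outDeg v ^ (G.inDeg v - 1) := by
  classical
  cases isEmpty_or_nonempty V with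
  | inl h =>
    haveI : IsEmpty A := ⟨fun a => h.false (G.src a)⟩
    simp
  | inr h =>
    obtain ⟨v₀⟩ := h
    obtain ⟨a₀, -⟩ := (G.outDeg_pos_iff v₀).1 (hout v₀)
    haveI : Nonempty A := ⟨a₀⟩
    have key := G.sum_card_arborescencesTo_lineDigraph_mul
    have hsplit : ∏ v, G.outDeg v ^ G.inDeg v = (∏ v, G.outDeg v ^ (G.inDeg v - 1)) * ∏ v, G.outDeg v := by
      rw [← Finset.prod_mul_distrib]
      refine Finset.prod_congr rfl fun v _ => ?_
      rw [← pow_succ, Nat.sub_add_cancel (hin v)]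
    rw [hsplit, mul_assoc, mul_comm (∏ v, G.outDeg v) _, ← mul_assoc] at key
    have hpos : 0 < ∏ v, G.outDeg v := Finset.prod_pos fun v _ => hout v
    have := Nat.eq_of_mul_eq_mul_right hpos key
    rw [this, mul_comm]

/-- **Knuth's Corollary (7), summed over the roots**: for a balanced directed multigraph on `N`
vertices with positive degrees, `κ(G*) = Σ_a t⁻(G*, a) = N · ∏_v σ_v^{σ_v − 1} · t⁻(G, s)` for any
vertex `s` («the number of oriented subtrees of `D*` with root `A_{j₀k₀}` is
`σ₁^{σ₁−1}⋯σ_m^{σ_m−1} t/σ_{k₀}`; there are `σ_{k₀}` roots with head `v_{k₀}`).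
[cite: Knuth1967, Corollary (7); Levine2011, eq. (2)] -/
theorem sum_card_arborescencesTo_lineDigraph_of_balanced (hbal : ∀ v, G.inDeg v = G.outDeg v)
    (hpos : ∀ v, 0 < G.outDeg v) (s : V) :
    ∑ a, (G.lineDigraph.arborescencesTo a).card =
      Fintype.card V * (∏ v, G.outDeg v ^ (G.outDeg v - 1)) * (G.arborescencesTo s).card := by
  classical
  rw [G.sum_card_arborescencesTo_lineDigraph (fun v => by rw [hbal v]; exact hpos v) hpos,
    Finset.sum_congr rfl fun (v : V) _ => G.card_arborescencesTo_eq_of_balanced' hbal v s,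
    Finset.sum_const, Finset.card_univ, smul_eq_mul]
  simp_rw [hbal]
  ring

end Count

/-! ### §4 Levine's examples: the bouquet (Cayley's `n^{n−1}`) and the two-vertex digraph `K_{m,n}` -/

section Examples

/-- «If `G` has just one vertex and `n` loops, then `LG` is the complete directed graph on `n` vertices
(which includes a loop at each vertex)» — and (2) is Cayley's formula: **`κ(LG) = n^{n−1}` rooted
spanning trees.** [cite: Levine2011, §1 (the case of one vertex with `n` loops, eq. (2))] -/
theorem sum_card_arborescencesTo_lineDigraph_bouquet (n : ℕ) (hn : 0 < n) :
    ∑ a : Fin n, ((⟨fun _ => (), fun _ => ()⟩ : Multidigraph Unit (Fin n)).lineDigraph.arborescencesTo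
        a).card = n ^ (n - 1) := by
  classical
  set G : Multidigraph Unit (Fin n) := ⟨fun _ => (), fun _ => ()⟩ with hG
  have hout : ∀ v, G.outDeg v = n := fun v => by
    rw [outDeg, show G.outArcs v = univ from Finset.eq_univ_of_forall fun a => mem_outArcs.2 rfl,
      Finset.card_univ, Fintype.card_fin]
  have hin : ∀ v, G.inDeg v = n := fun v => by
    rw [inDeg, show G.inArcs v = univ from Finset.eq_univ_of_forall fun a => mem_inArcs.2 rfl,
      Finset.card_univ, Fintype.card_fin]
  have ht : (G.arborescencesTo ()).card = 1 := by
    haveI : IsEmpty {v : Unit // v ≠ ()} := ⟨fun v => v.2 (Subsingleton.elim _ _)⟩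
    have h := G.card_arborescencesTo_eq_det_laplacian (R := ℤ) ()
    rw [Matrix.det_isEmpty] at h
    exact_mod_cast h
  rw [G.sum_card_arborescencesTo_lineDigraph_of_balanced (fun v => (hin v).trans (hout v).symm)
    (fun v => by rw [hout v]; exact hn) (), ht, Fintype.card_unique, Fintype.prod_unique, hout, one_mul,
    mul_one]

/-- «If `G` has two vertices `a` and `b` with `m` edges directed from `a` to `b` and `n` edges directed
from `b` to `a`», then `LG` is the bidirected complete bipartite graph and (2) reads
**`κ(LG) = (m+n) m^{n−1} n^{m−1}`**. [cite: Levine2011, §1 (the case `K_{m,n}`, eq. (2))] -/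
theorem sum_card_arborescencesTo_lineDigraph_twoVertex (m n : ℕ) (hm : 0 < m) (hn : 0 < n) :
    ∑ a : Fin m ⊕ Fin n,
      ((⟨fun a => Sum.elim (fun _ => true) (fun _ => false) a,
         fun a => Sum.elim (fun _ => false) (fun _ => true) a⟩ :
          Multidigraph Bool (Fin m ⊕ Fin n)).lineDigraph.arborescencesTo a).card =
      (m + n) * m ^ (n - 1) * n ^ (m - 1) := by
  classical
  set G : Multidigraph Bool (Fin m ⊕ Fin n) :=
    ⟨fun a => Sum.elim (fun _ => true) (fun _ => false) a,
     fun a => Sum.elim (fun _ => false) (fun _ => true) a⟩ with hG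
  -- degrees: `a = true` has out-degree `m`, in-degree `n`; `b = false` the other way round
  have houtArcs_t : G.outArcs true = univ.image Sum.inl := by
    ext a; rcases a with a | a <;> simp [outArcs, hG]
  have houtArcs_f : G.outArcs false = univ.image Sum.inr := by
    ext a; rcases a with a | a <;> simp [outArcs, hG]
  have hinArcs_t : G.inArcs true = univ.image Sum.inr := by
    ext a; rcases a with a | a <;> simp [inArcs, hG]
  have hinArcs_f : G.inArcs false = univ.image Sum.inl := by
    ext a; rcases a with a | a <;> simp [inArcs, hG]
  have hout_t : G.outDeg true = m := by
    rw [outDeg, houtArcs_t, Finset.card_image_of_injective _ Sum.inl_injective, card_univ, Fintype.card_fin]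
  have hout_f : G.outDeg false = n := by
    rw [outDeg, houtArcs_f, Finset.card_image_of_injective _ Sum.inr_injective, card_univ, Fintype.card_fin]
  have hin_t : G.inDeg true = n := by
    rw [inDeg, hinArcs_t, Finset.card_image_of_injective _ Sum.inr_injective, card_univ, Fintype.card_fin]
  have hin_f : G.inDeg false = m := by
    rw [inDeg, hinArcs_f, Finset.card_image_of_injective _ Sum.inl_injective, card_univ, Fintype.card_fin]
  -- `t⁻(G, true) = n` (choose the arc `b → a`), `t⁻(G, false) = m`, via the `1 × 1` minors
  have harc : ∀ u v : Bool, G.arcCount u v = if u = v then 0 else G.outDeg u := by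
    intro u v
    have hsum := G.outDeg_eq_sum_arcCount u
    rw [Fintype.sum_bool] at hsum
    have hself : G.arcCount u u = 0 := by
      rw [arcCount, arcsFromTo, Finset.card_eq_zero, Finset.filter_eq_empty_iff]
      rintro a - ⟨h1, h2⟩
      rcases a with a | a <;> simp [hG] at h1 h2 <;> simp_all
    rcases u with _ | _ <;> rcases v with _ | _ <;> simp_all
  have ht : ∀ s : Bool, ((G.arborescencesTo s).card : ℤ) = (G.outDeg (!s) : ℤ) := by
    intro s
    haveI : Unique {v : Bool // v ≠ s} :=
      { default := ⟨!s, by cases s <;> decide⟩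
        uniq := fun v => Subtype.ext (by
          rcases v with ⟨v, hv⟩
          cases s <;> cases v <;> simp_all) }
    have hs : (!s) ≠ s := by cases s <;> decide
    rw [G.card_arborescencesTo_eq_det_laplacian (R := ℤ) s, Matrix.det_unique,
      show (default : {v : Bool // v ≠ s}) = ⟨!s, hs⟩ from Subsingleton.elim _ _, submatrix_apply,
      laplacian_apply_self, harc, if_pos rfl, Nat.cast_zero, sub_zero]
  have ht_t : (G.arborescencesTo true).card = n := by
    have := ht true; rw [Bool.not_true, hout_f] at this; exact_mod_cast this
  have ht_f : (G.arborescencesTo false).card = m := by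
    have := ht false; rw [Bool.not_false, hout_t] at this; exact_mod_cast this
  rw [G.sum_card_arborescencesTo_lineDigraph (fun v => by cases v <;> simp [hin_t, hin_f, hm, hn])
    (fun v => by cases v <;> simp [hout_t, hout_f, hm, hn]), Fintype.sum_bool, Fintype.prod_bool,
    ht_t, ht_f, hout_t, hout_f, hin_t, hin_f]
  ring

end Examples

end Multidigraph

end Literature.Combinatorics.Digraph
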